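import Summits.CriticalPhenomena.PercolationContinuityZ3.Theorems.PercNearOneGluingNoHeavyLowerTailMajorityGluingQCertSymParts
import HarnessLib

/-!
# Part 6 of 18 of the orbit certificate of the cell `(12,7)` at `c = 157/100`: data and digest (lane prim-rate, constants-miner 1, gen 36; generated by cert/mksym.py)

Support file for the closed crux `NoHeavyLowerTail` (stmt-CriticalPhenomena-4575), majority-gluing line.  The symmetrised certificate of the cell `(12,7)`
(kit j286395, symcert.py) is checked IN PARTS (`…MajorityGluingQCertSymParts`): this file holds part 6 (0 multiplier terms, 2 marginal slacks,
0 rows, 0 squares; 4098 contributions) and its DIGEST `twelveSevenSymP6D` (43 orbit keys), verified by `decide +kernel` (`twelveSevenSymP6_digest`).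
The parts are glued in `…MajorityGluingQCertSymTwelveSeven`.  No sorries. [cite: VandenbergKahn2001, Thm 1.2 (p. 123)]
-/

namespace Summit.CriticalPhenomena.PercolationContinuityZ3.Theorems

namespace HubOnly
namespace QCert

/-- Row representatives of part 6: `(A, X, B, Y, n, masks of f(A,X), f(B,Y), f(A∪B,X∩Y), f(∅,X∪Y))`. -/
def twelveSevenSymP6Rows : List RowE :=
  []

/-- Square representatives of part 6: `(a, b, n, mask₁, mask₂)`. -/
def twelveSevenSymP6Sqs : List SqE :=
  []

/-- **Part 6** of the `(12,7)` orbit certificate at `157/100`. -/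
def twelveSevenSymP6 : SymCert :=
  ⟨⟨12, 7, 157, 100, 1, [], [], []⟩,
    [],
    [(0, 6, 17157800938174081024), (0, 4095, 5806157545751806976)],
    [twelveSevenSymP6Rows], [twelveSevenSymP6Sqs]⟩

/-- The digest of part 6: `(orbit key, coefficient total)` in increasing key order (computed by cert/mksym.py, verified below). -/
def twelveSevenSymP6D : List (ℕ × ℤ) :=
  [((4103 : ℕ), (17157800938174081024 : ℤ)), (8192, 5806157545751806976), (12296, 34315601876348162048), (12298, 17157800938174081024), 
    (12303, 154420208443566729216), (12304, 308840416887133458432), (12306, 154420208443566729216), (12319, 617680833774266916864), 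
    (12320, 1235361667548533833728), (12322, 617680833774266916864), (12351, 1441255278806622806016), (12352, 2882510557613245612032), 
    (12354, 1441255278806622806016), (12415, 2161882918209934209024), (12416, 4323765836419868418048), (12418, 2161882918209934209024), 
    (12543, 2161882918209934209024), (12544, 4323765836419868418048), (12546, 2161882918209934209024), (12799, 1441255278806622806016), 
    (12800, 2882510557613245612032), (12802, 1441255278806622806016), (13311, 617680833774266916864), (13312, 1235361667548533833728), 
    (13314, 617680833774266916864), (14335, 154420208443566729216), (14336, 308840416887133458432), (14338, 154420208443566729216), 
    (16383, 17157800938174081024), (16384, 34315601876348162048), (16386, 81025533941443957760), (32774, 319338665016349383680), 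
    (65550, 958015995049048151040), (131102, 1916031990098096302080), (262206, 2682444786137334822912), (524414, 2682444786137334822912), 
    (1048830, 1916031990098096302080), (2097662, 958015995049048151040), (4195326, 319338665016349383680), (8390654, 63867733003269876736), 
    (16781310, 5806157545751806976), (16781315, -17157800938174081024), (16785407, -5806157545751806976)]

/-- **The digest of part 6 is `twelveSevenSymP6D`** (kernel evaluation of the part's 4098 contributions). -/
theorem twelveSevenSymP6_digest : twelveSevenSymP6.digest 20 = twelveSevenSymP6D := by
  decide +kernel

end QCert
end HubOnly

end Summit.CriticalPhenomena.PercolationContinuityZ3.Theorems
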